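import Summits.QuantumFields.YangMills.Theorems.BalabanUVNodesN07RecordLettersReality
import HarnessLib

/-!
# NODE N07 — def-Y's PINNED AVERAGING LETTER `Q(U₀) = QOfRecord` RESPECTS THE TRACE SECTORS AT EVERY GUARDED BACKGROUND, EVERY `N ≥ 1`: the `𝔰𝔲(N)` directions of print's
# `Q_k(U₀)` are `𝔰𝔲(N)`-valued (✓`qLin_mem_lieSU`, conjugated by the unitary `Ū^k(U₀)(c)`), the `u(1)` directions are scalar (✓`exists_dIterL_phase_mul_star`); the complexification
# `Q_k(U₀)ᶜ` therefore maps TRACELESS-valued fields to traceless-valued ones and SCALAR-valued fields to scalar-valued ones ([B9] (3.13)–(3.16) p. 393; [15] (44) p. 285, (51) p. 286)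

Cell `pub-ymgap`, width seat `pub-ymgap-dag-n07-w3` (g26), CLAIM-19.  `--kind proof --supports stmt-QuantumFields-27238 --as helper`; count-neutral.  The trace companion of ✓p821508
`…N07RecordLettersReality` §4–§5 (`QOfRecord_starW`).  [15] = [Balaban1985Variational]; [B9] = [Balaban1985BackgroundPropagators].

CONTENTS (guard `SmallBelow (avOfRecord F N K) k U₀` as in every `Q(U₀)` statement of record).
* §1 (torus-generic) `trace_dIterL_lieSU_mul_star` (`tr(Q_k[X·U₀](c)·Ū(c)⋆) = 0` for `𝔰𝔲`-valued `X`), ★`trace_qSkewOp_eq_zero` (`𝔰𝔲`-valued in ⟹ traceless out), ★`qSkewOp_phase_eq_smul_one`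
  (`(iθ)·1 ↦ L^{-k}(iφ)·1`), `trace_skewField_eq_zero`, `skewField_smul_one`, ★★`trace_qCplxOp_eq_zero` (traceless-valued in ⟹ traceless out), ★★`qCplxOp_scalar` (scalar-valued in ⟹ scalar out).
* §2 (record) ★★★`QOfRecord_traceless`, ★★★`QOfRecord_scalar`.

HONEST LABELS.  Linear bookkeeping over this lineage's ✓`N07LinearisedAveragingKernel.qLin_mem_lieSU` and ✓`N07AveragingPhaseEquivariance`; no estimate; `G₁`, `K⁻¹`, `H₁`, `H♭`, `𝔊`, `π`,
`C^{𝔰𝔩}`, `W` trace letters still owed.  Count-neutral; N07 NOT discharged; P0 ⟨26900⟩ OPEN; R4 is the conditional finite-𝕋⁴ rung only.  Nothing here is a claim about the Yang–Mills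
mass gap (`Summit.QuantumFields`): finite torus, fixed `ε`; nothing continuum ∕ OS ∕ Clay.
-/

set_option autoImplicit false

noncomputable section

open scoped Matrix Matrix.Norms.L2Operator InnerProductSpace ComplexConjugate BigOperators

namespace Summit.QuantumFields.YangMills.Theorems.N07QOfRecordTraceSectors

open Literature.MathematicalPhysics.QuantumFieldTheory.Balaban1983to89
open Literature.MathematicalPhysics.QuantumFieldTheory.Balaban1983to89.T4Continuum (T4Family)
open T4Continuum BlockAveraging
open Node00
open B9SectCLatticeCarrier (Bond)
open B9Eq311L2Pairing (WL2)
open B11Eq103H1Complex (BondL2K)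
open ExpMeanLog (expMeanLogSU)
open T4AdjointCovarianceUnitary (lieSU mem_lieSU_iff conj_mem_lieSU toUnitary)
open Summit.QuantumFields.YangMills.BalabanUVNodes.N07LinearisedAveragingKernel (qLin_mem_lieSU)
open Summit.QuantumFields.YangMills.Theorems.N07QOfRecordFlatOnto (skewField_conjTranspose)
open Summit.QuantumFields.YangMills.Theorems.N07RecordLettersReality (exists_dIterL_phase_mul_star)

/-! ## §1  Print's `Q_k(U₀)`: `𝔰𝔲` directions stay traceless, `u(1)` directions stay scalar -/

section Torus

variable {P : Params} {N : ℕ} [NeZero N]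

/-- **`tr(Q_k(↑U₀)[b ↦ X_b U₀(b)](c) · Ū^k(U₀)(c)⋆) = 0` for `𝔰𝔲(N)`-valued `X`** — `X_bU₀(b) = U₀(b)Y_b` with `Y_b ∈ 𝔰𝔲(N)`, ✓`coe_iter_mul_qLin` and ✓`qLin_mem_lieSU`: the value is
`Ū(c)·q·Ū(c)⋆` with `q ∈ 𝔰𝔲(N)`. [cite: Balaban1985BackgroundPropagators, (3.13)–(3.15) p.393; Balaban1985Variational, (51) p.286] -/
theorem trace_dIterL_lieSU_mul_star {U₀ : GaugeField P 0 (SU N)} {k : ℕ}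
    (hSB : SmallBelow (fun j => blockAvg (P := P) (j := j) (expMeanLogSU (n := Fin N))) k U₀) (X : PBond P 0 → lieSU (Fin N)) (c : PBond P k) :
    (dIterL k (coeField U₀) (fun b => (X b : Matrix (Fin N) (Fin N) ℂ) * (U₀ b : Matrix (Fin N) (Fin N) ℂ)) c *
        star ((Averaging.iter (fun j => blockAvg (P := P) (j := j) (expMeanLogSU (n := Fin N))) k U₀ c : SU N) : Matrix (Fin N) (Fin N) ℂ)).trace = 0 := by
  set Y : PBond P 0 → lieSU (Fin N) := fun b =>
    ⟨((U₀ b)⁻¹ : SU N) * (X b : Matrix (Fin N) (Fin N) ℂ) * star (((U₀ b)⁻¹ : SU N) : Matrix (Fin N) (Fin N) ℂ), by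
      simpa only [T4AdjointCovarianceUnitary.coe_toUnitary] using conj_mem_lieSU (X b).2 (toUnitary (U₀ b)⁻¹)⟩ with hY
  have hdir : (fun b => (X b : Matrix (Fin N) (Fin N) ℂ) * (U₀ b : Matrix (Fin N) (Fin N) ℂ)) =
      fun b => (U₀ b : Matrix (Fin N) (Fin N) ℂ) * (Y b : Matrix (Fin N) (Fin N) ℂ) := by
    funext b
    simp only [hY, coe_inv_SU, star_star]
    rw [← mul_assoc, ← mul_assoc, coe_mul_star_coe_SU, one_mul]
  rw [hdir, ← coe_iter_mul_qLin hSB Y c, Matrix.trace_mul_cycle, star_coe_mul_coe_SU, one_mul]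
  exact (mem_lieSU_iff.1 (qLin_mem_lieSU hSB Y c)).2

/-- ★ **`qSkewOp k U₀` MAPS `𝔰𝔲(N)`-VALUED FIELDS TO TRACELESS FIELDS** under 35b's guard. [cite: Balaban1985BackgroundPropagators, (3.13)–(3.16) p.393; Balaban1985Variational, (51) p.286] -/
theorem trace_qSkewOp_eq_zero {U₀ : GaugeField P 0 (SU N)} {k : ℕ}
    (hSB : SmallBelow (fun j => blockAvg (P := P) (j := j) (expMeanLogSU (n := Fin N))) k U₀)
    {X : PBond P 0 → Matrix (Fin N) (Fin N) ℂ} (hX : ∀ b, X b ∈ lieSU (Fin N)) (c : PBond P k) : (qSkewOp k U₀ X c).trace = 0 := by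
  have h := trace_dIterL_lieSU_mul_star hSB (fun b => ⟨X b, hX b⟩) c
  rw [qSkewOp_apply, ← coeField_iter_eq_iterM k hSB, coeField_apply, Matrix.trace_smul]
  rw [show (fun b => X b * (U₀ b : Matrix (Fin N) (Fin N) ℂ)) = fun b => ((⟨X b, hX b⟩ : lieSU (Fin N)) : Matrix (Fin N) (Fin N) ℂ) * (U₀ b : Matrix (Fin N) (Fin N) ℂ)
    from rfl, h, smul_zero]

/-- ★ **`qSkewOp k U₀` MAPS THE PHASE FIELD `(iθ)·1` TO THE SCALAR FIELD `L^{-k}(iφ)·1`** under 35b's guard. [cite: Balaban1985BackgroundPropagators, (3.13)–(3.16) p.393; Balaban1987RG1, (0.4) p.253] -/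
theorem qSkewOp_phase_eq_smul_one {U₀ : GaugeField P 0 (SU N)} {k : ℕ}
    (hSB : SmallBelow (fun j => blockAvg (P := P) (j := j) (expMeanLogSU (n := Fin N))) k U₀) (θ : PBond P 0 → ℝ) :
    ∃ φ : PBond P k → ℝ, ∀ c, qSkewOp k U₀ (fun b => ((((θ b : ℝ) : ℂ) * Complex.I)) • (1 : Matrix (Fin N) (Fin N) ℂ)) c =
      ((P.L : ℂ) ^ k)⁻¹ • (((((φ c : ℝ) : ℂ) * Complex.I)) • (1 : Matrix (Fin N) (Fin N) ℂ)) := by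
  obtain ⟨φ, hφ⟩ := exists_dIterL_phase_mul_star hSB θ
  refine ⟨φ, fun c => ?_⟩
  rw [qSkewOp_apply, ← coeField_iter_eq_iterM k hSB, coeField_apply]
  rw [show (fun b => ((((θ b : ℝ) : ℂ) * Complex.I)) • (1 : Matrix (Fin N) (Fin N) ℂ) * (U₀ b : Matrix (Fin N) (Fin N) ℂ)) =
      fun b => ((((θ b : ℝ) : ℂ) * Complex.I)) • (U₀ b : Matrix (Fin N) (Fin N) ℂ) from funext fun b => by rw [smul_mul_assoc, one_mul], hφ c]

omit [NeZero N] in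
/-- The skew part of a traceless matrix field is traceless. [cite: Balaban1985BackgroundPropagators, p.393 (bookkeeping)] -/
theorem trace_skewField_eq_zero {ι : Type*} {Y : ι → Matrix (Fin N) (Fin N) ℂ} (hY : ∀ b, (Y b).trace = 0) (b : ι) : (skewField Y b).trace = 0 := by
  rw [skewField_apply, Matrix.trace_smul, Matrix.trace_sub, Matrix.trace_conjTranspose, hY, star_zero, sub_zero, smul_zero]

omit [NeZero N] in
/-- The skew part of a scalar field `r·1` is the phase field `(i·Im r)·1`. [cite: Balaban1985BackgroundPropagators, p.393 (bookkeeping)] -/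
theorem skewField_smul_one {ι : Type*} (r : ι → ℂ) (b : ι) :
    skewField (fun b => r b • (1 : Matrix (Fin N) (Fin N) ℂ)) b = (((((r b).im : ℝ) : ℂ) * Complex.I)) • (1 : Matrix (Fin N) (Fin N) ℂ) := by
  rw [skewField_apply, Matrix.conjTranspose_smul, Matrix.conjTranspose_one, ← sub_smul, smul_smul]
  congr 1
  rw [Complex.star_def, Complex.sub_conj]
  apply Complex.ext <;> simp

/-- ★★ **PRINT'S COMPLEXIFIED `Q_k(U₀)` MAPS TRACELESS-VALUED FIELDS TO TRACELESS FIELDS** under 35b's guard (`Y ↦ skew Y + i·skew(−iY)`, both `𝔰𝔲`-valued).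
[cite: Balaban1985BackgroundPropagators, (3.13) p.393; Balaban1985Variational, (51) p.286] -/
theorem trace_qCplxOp_eq_zero {U₀ : GaugeField P 0 (SU N)} {k : ℕ}
    (hSB : SmallBelow (fun j => blockAvg (P := P) (j := j) (expMeanLogSU (n := Fin N))) k U₀)
    {Y : PBond P 0 → Matrix (Fin N) (Fin N) ℂ} (hY : ∀ b, (Y b).trace = 0) (c : PBond P k) : (qCplxOp k U₀ Y c).trace = 0 := by
  have hY' : ∀ b, (((-Complex.I) • Y) b).trace = 0 := fun b => by rw [Pi.smul_apply, Matrix.trace_smul, hY, smul_zero]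
  have h1 : ∀ b, skewField Y b ∈ lieSU (Fin N) := fun b =>
    mem_lieSU_iff.2 ⟨by rw [Matrix.star_eq_conjTranspose]; exact skewField_conjTranspose Y b, trace_skewField_eq_zero hY b⟩
  have h2 : ∀ b, skewField (-Complex.I • Y) b ∈ lieSU (Fin N) := fun b =>
    mem_lieSU_iff.2 ⟨by rw [Matrix.star_eq_conjTranspose]; exact skewField_conjTranspose _ b, trace_skewField_eq_zero hY' b⟩
  unfold qCplxOp
  rw [cplxOp_apply, Pi.add_apply, Pi.smul_apply, Matrix.trace_add, Matrix.trace_smul, trace_qSkewOp_eq_zero hSB h1, trace_qSkewOp_eq_zero hSB h2, smul_zero,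
    add_zero]

/-- ★★ **PRINT'S COMPLEXIFIED `Q_k(U₀)` MAPS SCALAR-VALUED FIELDS TO SCALAR FIELDS** under 35b's guard (`skew(r·1) = (i Im r)·1`, `skew(−i r·1) = (−i Re r)·1`, §1's phase lemma).
[cite: Balaban1985BackgroundPropagators, (3.13) p.393; Balaban1987RG1, (0.4) p.253] -/
theorem qCplxOp_scalar {U₀ : GaugeField P 0 (SU N)} {k : ℕ}
    (hSB : SmallBelow (fun j => blockAvg (P := P) (j := j) (expMeanLogSU (n := Fin N))) k U₀)
    {Y : PBond P 0 → Matrix (Fin N) (Fin N) ℂ} (hY : ∀ b, ∃ r : ℂ, Y b = r • (1 : Matrix (Fin N) (Fin N) ℂ)) (c : PBond P k) :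
    ∃ r : ℂ, qCplxOp k U₀ Y c = r • (1 : Matrix (Fin N) (Fin N) ℂ) := by
  choose r hr using hY
  have hYf : Y = fun b => r b • (1 : Matrix (Fin N) (Fin N) ℂ) := funext hr
  have hYf' : (-Complex.I) • Y = fun b => (-Complex.I * r b) • (1 : Matrix (Fin N) (Fin N) ℂ) := by
    funext b; rw [Pi.smul_apply, hr, smul_smul]
  have hs1 : skewField Y = fun b => (((((r b).im : ℝ) : ℂ) * Complex.I)) • (1 : Matrix (Fin N) (Fin N) ℂ) := by
    funext b; rw [hYf, skewField_smul_one]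
  have hs2 : skewField ((-Complex.I) • Y) = fun b => (((((-Complex.I * r b).im : ℝ) : ℂ) * Complex.I)) • (1 : Matrix (Fin N) (Fin N) ℂ) := by
    funext b; rw [hYf', skewField_smul_one]
  obtain ⟨φ₁, h₁⟩ := qSkewOp_phase_eq_smul_one hSB fun b => (r b).im
  obtain ⟨φ₂, h₂⟩ := qSkewOp_phase_eq_smul_one hSB fun b => (-Complex.I * r b).im
  refine ⟨((P.L : ℂ) ^ k)⁻¹ * (((φ₁ c : ℝ) : ℂ) * Complex.I) + Complex.I * (((P.L : ℂ) ^ k)⁻¹ * (((φ₂ c : ℝ) : ℂ) * Complex.I)), ?_⟩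
  unfold qCplxOp
  rw [cplxOp_apply, Pi.add_apply, Pi.smul_apply, hs1, hs2, h₁ c, h₂ c, smul_smul, smul_smul, smul_smul, ← add_smul]
  congr 1
  ring

end Torus

/-! ## §2  def-Y's `Q(U₀) = QOfRecord F N k U₀` respects both sectors at every guarded background -/

section RecordQ

variable (F : T4Family) (N : ℕ) [NeZero N] {K : ℕ} (k : ℕ) (U₀ : GaugeField (F.P K) 0 (SU N)) [Fact (0 < c0Rec F K k)]

omit [Fact (0 < c0Rec F K k)] in
/-- ★★★ **def-Y's PINNED AVERAGING `Q(U₀)` MAPS TRACELESS-VALUED BOND FIELDS TO TRACELESS-VALUED `k`-FIELDS** under 35b's guard `SmallBelow (avOfRecord F N K) k U₀`.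
[cite: Balaban1985BackgroundPropagators, (3.13)–(3.16) p.393; Balaban1985Variational, (44) p.285, (51) p.286] -/
theorem QOfRecord_traceless (h : SmallBelow (avOfRecord F N K) k U₀) {A : BondL2K ℂ (F.P K).d (fun _ => (F.P K).sitesPerDir 0) (c0Rec F K k) (WRec N)}
    (hA : ∀ b, (phiRec N (WL2.equiv ℂ _ (WRec N) A b)).trace = 0) (c : PBond (F.P K) k) :
    (phiRec N (WL2.equiv ℂ (wBRec F K k) (WRec N) (QOfRecord F N k U₀ A) c)).trace = 0 := by
  rw [QOfRecord_apply, LinearEquiv.apply_symm_apply]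
  exact trace_qCplxOp_eq_zero h (fun b => by rw [bondFieldIn_apply]; exact hA _) c

omit [Fact (0 < c0Rec F K k)] in
/-- ★★★ **def-Y's PINNED AVERAGING `Q(U₀)` MAPS SCALAR-VALUED BOND FIELDS TO SCALAR-VALUED `k`-FIELDS** under 35b's guard `SmallBelow (avOfRecord F N K) k U₀`.
[cite: Balaban1985BackgroundPropagators, (3.13)–(3.16) p.393; Balaban1987RG1, (0.4) p.253] -/
theorem QOfRecord_scalar (h : SmallBelow (avOfRecord F N K) k U₀) {A : BondL2K ℂ (F.P K).d (fun _ => (F.P K).sitesPerDir 0) (c0Rec F K k) (WRec N)}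
    (hA : ∀ b, ∃ r : ℂ, phiRec N (WL2.equiv ℂ _ (WRec N) A b) = r • (1 : Matrix (Fin N) (Fin N) ℂ)) (c : PBond (F.P K) k) :
    ∃ r : ℂ, phiRec N (WL2.equiv ℂ (wBRec F K k) (WRec N) (QOfRecord F N k U₀ A) c) = r • (1 : Matrix (Fin N) (Fin N) ℂ) := by
  rw [QOfRecord_apply, LinearEquiv.apply_symm_apply]
  exact qCplxOp_scalar h (fun b => by rw [bondFieldIn_apply]; exact hA _) c

end RecordQ

end Summit.QuantumFields.YangMills.Theorems.N07QOfRecordTraceSectors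

end
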